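import Summits.BirchSwinnertonDyer.BirchSwinnertonDyer.Theorems.AlignedTransportAtTwoMainConjectureOfRankZeroBSDAtTwoCubicSplitStratumLayerTwoGeneralRelationDoor
import Summits.BirchSwinnertonDyer.BirchSwinnertonDyer.Theorems.AlignedTransportAtTwoMainConjectureOfRankZeroBSDAtTwoCubicCarrierRoad
import Summits.BirchSwinnertonDyer.BirchSwinnertonDyer.Theorems.AlignedTransportAtTwoMainConjectureOfRankZeroBSDAtTwoCubicSplitStratumSeedN10913
import Literature.NumberTheory.NumberFields.CubicFieldIntegers
import Literature.NumberTheory.NumberFields.CubicFieldResiduePrimes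
import HarnessLib

/-!
# Route `AlignedTransportAtTwo`, crux C2 `MainConjectureOfRankZeroBSDAtTwo` (stmt-BirchSwinnertonDyer-22298):
# ROW `N = 10913` — A SPLIT-STRATUM SEED (`Δ_min ≡ 1 (mod 8)`, Dedekind-type cubic field `−1559`) BY THE GENERAL RELATION ROAD AT LAYER TWO, LINEAR SHAPE:
# ★★★ **`rank₂ Cl(K_m) ≤ 1 ∀ m`, `μ₂ = 0`, `λ₂ ≤ 1` — UNCONDITIONALLY — for every cyclotomic `ℤ₂`-extension of the cubic `2`-torsion field `ℚ(β)` of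
# `⟨1, 1, 1, −244, −1572⟩`**, from ONE relation `c³·σc = 1` in `Cl(K_2)`, `K_2 = ℚ(β)·ℚ(ζ₁₆)⁺` (`3 + X = (X − 1) + 2·2`, `d = 1`)

HONEST FRAMING (cell `bsd-f1-sign2`, WIDTH-5 attached prover seat `bsd-line-att-p4` gen 46 on line `birth` of the lead `bsd-line-att-p2`;
`--supports` stmt-BirchSwinnertonDyer-22298, closes nothing; BSD is NOT proved by any of this; the crux C2, its verdict «blocked-on
`Rank1Residual.GreenbergMuConjectureIrreducible`» and every registered stub are untouched).  THEOREMS ONLY (no `def`, no named fact, no instance, no `sorry`).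

WHAT.  `W = ⟨1, 1, 1, −244, −1572⟩` (`N = 10913`, `Δ_min ≡ 1 (mod 8)`: ON the Kilford stratum; cubic `2`-torsion field `K = ℚ(β) = ℚ(θ)`, `θ³ − 7θ² + 14θ + 8 = 0`, `𝓞_K = ℤ ⊕ ℤθ ⊕ ℤδ`,
`δ = (θ² + θ)/2`, `h_K = 1` — this seat's `CubicDisc1559` and `…CubicSplitStratumSeedN10913`) is a seed of att-p3 g53's split-stratum census with `r = 1`
(unit `ε = 89 + 176θ + 66δ`, dyadic bits `(0, 1, 1)`: `ε ≡ −1 (mod 𝔭₁³)` at `𝔭₁ = (−1 − 3θ + 3δ)`, `ε ≡ 3 (mod 𝔭'³)` at `𝔭' = (−35 + 17θ − 4δ)`)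
whose class `c = [𝔮]` at layer two is NOT killed by `(1+σ)²` (this seat's generator search: `𝔠(σ𝔠)²σ²𝔠` not found principal) but satisfies the LINEAR relation
**`𝔮³·σ𝔮 = (y)`** (`σc = c⁻³`: a cyclic module with SCALAR Galois action, the `λ₂ = 1` signature).  WHAT FIRES: this seat's GENERAL layer-two coordinate door
`…CubicSplitStratumLayerTwoGeneralRelationDoor` (Literature `ClassicalMuVanishesLayerTwoGeneralRelationCertificateTwoSplit`): `q₀ = 7 − 2θ` (norm `±113`, `(q₀)` maximal,
`q₀ ≡ 3 (mod 𝔭₁³)`), `t = 8`, `𝔮 = (q₀, s₂ − 8)`, exponents `e = (3, 1, 0, 0)` (`3 + X = (X−1)·1 + 2·2`, `d = 1 ≤ 2² − 2`),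
`y = [[31, -12, 2], [-13, 7, -2], [34, -16, 4], [-20, 12, -3]]` on `(1, s₁, s₂, s₁s₂) × (1, θ, δ)` (LLL in the degree-`12` field, pure python, seconds; `N_{K_2/K}(y) = ε_y q₀⁴`); memberships `y ∈ 𝔮³`
(`y = λq₀³ + μ(s₂ − 8)³`) and `y ∈ σ𝔮` (`y = λ'q₀ + μ'(σs₂ − 8)`) as ring identities in `𝓞_K[s₁,s₂]`; coprimality of the four conjugates by three Bézouts in `𝓞_K`.
THEN (★★★ `classGroupPRank_le_and_mu_lambda_cubicField_n10913`, UNCONDITIONAL) for `β` ANY root of the `2`-division cubic and EVERY cyclotomic `ℤ₂`-extension `κ` of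
`ℚ(β)`: `rank₂ Cl(K_m) ≤ 1 ∀ m`, `μ₂(κ) = 0`, `λ₂(κ) ≤ 1` (`X` pro-cyclic); and (★) `MC₂(W)` modulo PRINT⁵ + MuIneqʳ + the crux's own hypotheses (att-p5 g24's
carrier road).  BSD is NOT proved; nothing is closed; C2's verdict is untouched.

References: [Washington1997] §13.1, §13.3 Lemmas 13.15, 13.18, Prop. 13.22–13.23; [Lang1990] Ch. 13 §4 Lemma 4.1; [Fukuda1994] Thm. 1; [Gras2003] IV.4;
[NeukirchANT1999] Ch. I §3, §8, Ch. III (1.6)–(1.7); [Omeara1963] §63B; [Cohen1993] §4.7, §6.5; [Marcus2018] Ch. 3 Thm. 27 and Ex. 21; [LMFDB] ec 10913,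
nf 3.1.1559.1; [Kato2004Asterisque] Thm. 17.4; [GreenbergLNM1716] Thm. 4.1; tree: this seat's `…CubicSplitStratumLayerTwoGeneralRelationDoor`,
`Literature/…/ClassicalMuVanishesLayerTwoGeneralRelationCertificateTwoSplit`, `CubicFieldDiscriminant1559{,ClassNumber}`, `…CubicSplitStratumSeedN10913`;
att-p4 g43/g45 `…CubicLayerThreeGeneralRelationRowN*` (membership-certificate template); att-p5 g24 `…CubicCarrierRoad`.
-/

set_option linter.dupNamespace false
set_option autoImplicit false

noncomputable section

open scoped Classical NumberField nonZeroDivisors IntermediateField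

namespace Summit.BirchSwinnertonDyer.BirchSwinnertonDyer.Theorems.AlignedTransportAtTwoCubicSplitStratumLayerTwoGeneralRelationRowN10913

open NumberField IsDedekindDomain Polynomial WeierstrassCurve IntermediateField CongruenceSubgroup Module
  Literature.NumberTheory.IwasawaTheory Literature.NumberTheory.GaloisRepresentations
  Literature.NumberTheory.EllipticCurves Literature.NumberTheory.EllipticCurves.Greenberg1999
  Literature.NumberTheory.EllipticCurves.ModularForms Literature.NumberTheory.EllipticCurves.Rank1Residual
  Literature.NumberTheory.EllipticCurves.Module
  Literature.NumberTheory.NumberFields Literature.NumberTheory.CubicFields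
  Summit.BirchSwinnertonDyer.Rank1Residual Summit.BirchSwinnertonDyer.Rank1Residual.X1.MuLambda
  Summit.BirchSwinnertonDyer.Rank1Residual.X5 Summit.BirchSwinnertonDyer.Rank1Residual.X5.O1
  Summit.BirchSwinnertonDyer.Rank1Residual.X5.Instances Summit.BirchSwinnertonDyer.Rank1Residual.F1Sign2
  Summit.BirchSwinnertonDyer.BirchSwinnertonDyer.Theorems.Rank1ResidualX1Defs
  Summit.BirchSwinnertonDyer.BirchSwinnertonDyer.Theorems.AlignedTransportAtTwoCubicCarrierRoad
  Summit.BirchSwinnertonDyer.BirchSwinnertonDyer.Theorems.AlignedTransportAtTwoCubicSplitStratumSeedN10913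
  Summit.BirchSwinnertonDyer.BirchSwinnertonDyer.Theorems.AlignedTransportAtTwoCubicSplitStratumLayerTwoGeneralRelationDoor

/-! ## §1 Residue maps of `𝓞_{ℚ(β)} = ℤ ⊕ ℤθ ⊕ ℤδ` (through `θ`, every odd `p`), the dyadic primes `𝔭₁ = (-1 - 3 * θ + 3 * δ)`, `𝔭' = (-35 + 17 * θ - 4 * δ)`, maximality of `(q₀)` -/

/-- `ψ_113 : 𝓞_{ℚ(β)} → ℤ/113` with `ψ(θ) = 60` (hence `ψ(δ) = 22`) — the degree-one prime `(113, θ − 60) = (q₀)`. [cite: Marcus2018, Ch. 3, Thm. 27] -/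
theorem exists_residueHom_q {β : AlgebraicClosure ℚ} (hβ : aeval β ((⟨1, 1, 1, -244, -1572⟩ : WeierstrassCurve ℤ).baseChange ℚ).twoTorsionPolynomial.toPoly = 0) :
    ∃ ψ : 𝓞 ↥(IntermediateField.adjoin ℚ ({β} : Set (AlgebraicClosure ℚ))) →+* ZMod 113, ψ (MonicCubic.thetaInt (aeval_theta_n10913 hβ)) = ((60 : ℤ) : ZMod 113) :=
  haveI : FiniteDimensional ℚ ↥(IntermediateField.adjoin ℚ ({β} : Set (AlgebraicClosure ℚ))) := IntermediateField.adjoin.finiteDimensional ((AlgebraicClosure.isAlgebraic ℚ).isAlgebraic β).isIntegral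
  haveI : NumberField ↥(IntermediateField.adjoin ℚ ({β} : Set (AlgebraicClosure ℚ))) := NumberField.mk
  haveI : Fact (Nat.Prime 113) := ⟨by norm_num⟩
  MonicCubic.exists_residueHom CubicDisc1559.irreducible_polyQ (aeval_theta_n10913 hβ) (finrank_cubicField_n10913 hβ)
    (CubicDisc1559.mem2 (finrank_cubicField_n10913 hβ) (aeval_theta_n10913 hβ)) (by norm_num) ((60) : ℤ) (by decide)

/-- `χ_17 : 𝓞_{ℚ(β)} → ℤ/17` with `χ(θ) = 11` (hence `χ(δ) = 15`); `±ε` are non-squares there (`χ(ε) = 6`, `17 ≡ 1 (mod 4)`). [cite: Marcus2018, Ch. 3, Thm. 27] -/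
theorem exists_residueHom_chi {β : AlgebraicClosure ℚ} (hβ : aeval β ((⟨1, 1, 1, -244, -1572⟩ : WeierstrassCurve ℤ).baseChange ℚ).twoTorsionPolynomial.toPoly = 0) :
    ∃ ψ : 𝓞 ↥(IntermediateField.adjoin ℚ ({β} : Set (AlgebraicClosure ℚ))) →+* ZMod 17, ψ (MonicCubic.thetaInt (aeval_theta_n10913 hβ)) = ((11 : ℤ) : ZMod 17) :=
  haveI : FiniteDimensional ℚ ↥(IntermediateField.adjoin ℚ ({β} : Set (AlgebraicClosure ℚ))) := IntermediateField.adjoin.finiteDimensional ((AlgebraicClosure.isAlgebraic ℚ).isAlgebraic β).isIntegral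
  haveI : NumberField ↥(IntermediateField.adjoin ℚ ({β} : Set (AlgebraicClosure ℚ))) := NumberField.mk
  haveI : Fact (Nat.Prime 17) := ⟨by norm_num⟩
  MonicCubic.exists_residueHom CubicDisc1559.irreducible_polyQ (aeval_theta_n10913 hβ) (finrank_cubicField_n10913 hβ)
    (CubicDisc1559.mem2 (finrank_cubicField_n10913 hβ) (aeval_theta_n10913 hβ)) (by norm_num) ((11) : ℤ) (by decide)

/-- **`N(𝔭₁) = 2`** for `𝔭₁ = (-1 - 3 * θ + 3 * δ)` (the bit-`0` dyadic prime: every unit is `≡ ±1 (mod 𝔭₁³)`). [cite: Marcus2018, Ch. 3, Thm. 27 and Exercise 21] -/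
theorem absNorm_span_pi1_n10913 {β : AlgebraicClosure ℚ} (hβ : aeval β ((⟨1, 1, 1, -244, -1572⟩ : WeierstrassCurve ℤ).baseChange ℚ).twoTorsionPolynomial.toPoly = 0) :
    haveI : FiniteDimensional ℚ ↥(IntermediateField.adjoin ℚ ({β} : Set (AlgebraicClosure ℚ))) := IntermediateField.adjoin.finiteDimensional ((AlgebraicClosure.isAlgebraic ℚ).isAlgebraic β).isIntegral
    haveI : NumberField ↥(IntermediateField.adjoin ℚ ({β} : Set (AlgebraicClosure ℚ))) := NumberField.mk
    Ideal.absNorm (Ideal.span {((-1 : 𝓞 ↥(IntermediateField.adjoin ℚ ({β} : Set (AlgebraicClosure ℚ)))) + (-3 : 𝓞 ↥(IntermediateField.adjoin ℚ ({β} : Set (AlgebraicClosure ℚ)))) * MonicCubic.thetaInt (aeval_theta_n10913 hβ) + (3 : 𝓞 ↥(IntermediateField.adjoin ℚ ({β} : Set (AlgebraicClosure ℚ)))) * MonicCubic.thetaInt (CubicDisc1559.delta_root (aeval_theta_n10913 hβ)))}) = 2 := by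
  haveI : FiniteDimensional ℚ ↥(IntermediateField.adjoin ℚ ({β} : Set (AlgebraicClosure ℚ))) := IntermediateField.adjoin.finiteDimensional ((AlgebraicClosure.isAlgebraic ℚ).isAlgebraic β).isIntegral
  haveI : NumberField ↥(IntermediateField.adjoin ℚ ({β} : Set (AlgebraicClosure ℚ))) := NumberField.mk
  rw [show (((-1 : 𝓞 ↥(IntermediateField.adjoin ℚ ({β} : Set (AlgebraicClosure ℚ)))) + (-3 : 𝓞 ↥(IntermediateField.adjoin ℚ ({β} : Set (AlgebraicClosure ℚ)))) * MonicCubic.thetaInt (aeval_theta_n10913 hβ) + (3 : 𝓞 ↥(IntermediateField.adjoin ℚ ({β} : Set (AlgebraicClosure ℚ)))) * MonicCubic.thetaInt (CubicDisc1559.delta_root (aeval_theta_n10913 hβ))) : 𝓞 ↥(IntermediateField.adjoin ℚ ({β} : Set (AlgebraicClosure ℚ)))) = (-1 - 3 * MonicCubic.thetaInt (aeval_theta_n10913 hβ) + 3 * MonicCubic.thetaInt (CubicDisc1559.delta_root (aeval_theta_n10913 hβ)) : 𝓞 ↥(IntermediateField.adjoin ℚ ({β} : Set (AlgebraicClosure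 ℚ)))) by ring, Ideal.absNorm_span_singleton]
  exact CubicDisc1559.natAbs_norm_piA (finrank_cubicField_n10913 hβ) (aeval_theta_n10913 hβ)

/-- **`N(𝔭') = 2`** for `𝔭' = (-35 + 17 * θ - 4 * δ)` (a bit-`1` dyadic prime: the unit `ε` is `≡ ±3 (mod 𝔭'³)`, not a norm from `ℚ(β,√2)`). [cite: Marcus2018, Ch. 3, Thm. 27 and Exercise 21] -/
theorem absNorm_span_pip_n10913 {β : AlgebraicClosure ℚ} (hβ : aeval β ((⟨1, 1, 1, -244, -1572⟩ : WeierstrassCurve ℤ).baseChange ℚ).twoTorsionPolynomial.toPoly = 0) :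
    haveI : FiniteDimensional ℚ ↥(IntermediateField.adjoin ℚ ({β} : Set (AlgebraicClosure ℚ))) := IntermediateField.adjoin.finiteDimensional ((AlgebraicClosure.isAlgebraic ℚ).isAlgebraic β).isIntegral
    haveI : NumberField ↥(IntermediateField.adjoin ℚ ({β} : Set (AlgebraicClosure ℚ))) := NumberField.mk
    Ideal.absNorm (Ideal.span {((-35 : 𝓞 ↥(IntermediateField.adjoin ℚ ({β} : Set (AlgebraicClosure ℚ)))) + (17 : 𝓞 ↥(IntermediateField.adjoin ℚ ({β} : Set (AlgebraicClosure ℚ)))) * MonicCubic.thetaInt (aeval_theta_n10913 hβ) + (-4 : 𝓞 ↥(IntermediateField.adjoin ℚ ({β} : Set (AlgebraicClosure ℚ)))) * MonicCubic.thetaInt (CubicDisc1559.delta_root (aeval_theta_n10913 hβ)))}) = 2 := by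
  haveI : FiniteDimensional ℚ ↥(IntermediateField.adjoin ℚ ({β} : Set (AlgebraicClosure ℚ))) := IntermediateField.adjoin.finiteDimensional ((AlgebraicClosure.isAlgebraic ℚ).isAlgebraic β).isIntegral
  haveI : NumberField ↥(IntermediateField.adjoin ℚ ({β} : Set (AlgebraicClosure ℚ))) := NumberField.mk
  rw [show (((-35 : 𝓞 ↥(IntermediateField.adjoin ℚ ({β} : Set (AlgebraicClosure ℚ)))) + (17 : 𝓞 ↥(IntermediateField.adjoin ℚ ({β} : Set (AlgebraicClosure ℚ)))) * MonicCubic.thetaInt (aeval_theta_n10913 hβ) + (-4 : 𝓞 ↥(IntermediateField.adjoin ℚ ({β} : Set (AlgebraicClosure ℚ)))) * MonicCubic.thetaInt (CubicDisc1559.delta_root (aeval_theta_n10913 hβ))) : 𝓞 ↥(IntermediateField.adjoin ℚ ({β} : Set (AlgebraicClosure ℚ)))) = (-35 + 17 * MonicCubic.thetaInt (aeval_theta_n10913 hβ) - 4 * MonicCubic.thetaInt (CubicDisc1559.delta_root (aeval_theta_n10913 hβ)) : 𝓞 ↥(IntermediateField.adjoin ℚ ({β} : Set (AlgebraicClosure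 ℚ)))) by ring, Ideal.absNorm_span_singleton]
  exact CubicDisc1559.natAbs_norm_piB (finrank_cubicField_n10913 hβ) (aeval_theta_n10913 hβ)

/-- **`(q₀) = (113, θ − 60)` is maximal** (kernel of `ψ_113`; `113 = q₀·q₀'`, `θ − 60 = q₀·w`, `q₀ ∈ (113, θ − 60)` with explicit witnesses on `1, θ, δ`).
[cite: Marcus2018, Ch. 3, Thm. 27] -/
theorem isMaximal_span_q0_n10913 {β : AlgebraicClosure ℚ} (hβ : aeval β ((⟨1, 1, 1, -244, -1572⟩ : WeierstrassCurve ℤ).baseChange ℚ).twoTorsionPolynomial.toPoly = 0) :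
    haveI : FiniteDimensional ℚ ↥(IntermediateField.adjoin ℚ ({β} : Set (AlgebraicClosure ℚ))) := IntermediateField.adjoin.finiteDimensional ((AlgebraicClosure.isAlgebraic ℚ).isAlgebraic β).isIntegral
    haveI : NumberField ↥(IntermediateField.adjoin ℚ ({β} : Set (AlgebraicClosure ℚ))) := NumberField.mk
    (Ideal.span {((7 : 𝓞 ↥(IntermediateField.adjoin ℚ ({β} : Set (AlgebraicClosure ℚ)))) + (-2 : 𝓞 ↥(IntermediateField.adjoin ℚ ({β} : Set (AlgebraicClosure ℚ)))) * MonicCubic.thetaInt (aeval_theta_n10913 hβ) + (0 : 𝓞 ↥(IntermediateField.adjoin ℚ ({β} : Set (AlgebraicClosure ℚ)))) * MonicCubic.thetaInt (CubicDisc1559.delta_root (aeval_theta_n10913 hβ)))}).IsMaximal := by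
  haveI : FiniteDimensional ℚ ↥(IntermediateField.adjoin ℚ ({β} : Set (AlgebraicClosure ℚ))) := IntermediateField.adjoin.finiteDimensional ((AlgebraicClosure.isAlgebraic ℚ).isAlgebraic β).isIntegral
  haveI : NumberField ↥(IntermediateField.adjoin ℚ ({β} : Set (AlgebraicClosure ℚ))) := NumberField.mk
  haveI : Fact (Nat.Prime 113) := ⟨by norm_num⟩
  have hθ := aeval_theta_n10913 hβ
  have h3 := finrank_cubicField_n10913 hβ
  obtain ⟨ψ, hψ⟩ := exists_residueHom_q hβ
  set θI : 𝓞 ↥(IntermediateField.adjoin ℚ ({β} : Set (AlgebraicClosure ℚ))) := MonicCubic.thetaInt hθ with hθI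
  set δI : 𝓞 ↥(IntermediateField.adjoin ℚ ({β} : Set (AlgebraicClosure ℚ))) := MonicCubic.thetaInt (CubicDisc1559.delta_root hθ) with hδI
  obtain ⟨hX2, hXY, hY2⟩ := CubicDisc1559.mul_table hθ
  rw [← hθI, ← hδI] at hX2 hXY hY2
  have hexp : ¬ 113 ∣ RingOfIntegers.exponent (MonicCubic.thetaInt hθ) := CubicDisc1559.not_dvd_exponent h3 hθ (by norm_num) (by norm_num)
  have hker := MonicCubic.ker_residueHom_eq_span CubicDisc1559.irreducible_polyQ hθ hexp ψ hψ
  have hspan : Ideal.span {((113 : ℕ) : 𝓞 ↥(IntermediateField.adjoin ℚ ({β} : Set (AlgebraicClosure ℚ)))), MonicCubic.thetaInt hθ - ((60 : ℤ) : 𝓞 ↥(IntermediateField.adjoin ℚ ({β} : Set (AlgebraicClosure ℚ))))} = Ideal.span {((7 : 𝓞 ↥(IntermediateField.adjoin ℚ ({β} : Set (AlgebraicClosure ℚ)))) + (-2 : 𝓞 ↥(IntermediateField.adjoin ℚ ({β} : Set (AlgebraicClosure ℚ)))) * θI + (0 : 𝓞 ↥(IntermediateField.adjoin ℚ ({β}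 : Set (AlgebraicClosure ℚ)))) * δI)} := by
    rw [← hθI]
    apply le_antisymm
    · rw [Ideal.span_le]
      intro x hx
      simp only [Set.mem_insert_iff, Set.mem_singleton_iff] at hx
      rcases hx with rfl | rfl
      · exact Ideal.mem_span_singleton'.mpr ⟨((7 : 𝓞 ↥(IntermediateField.adjoin ℚ ({β} : Set (AlgebraicClosure ℚ)))) + (-18 : 𝓞 ↥(IntermediateField.adjoin ℚ ({β} : Set (AlgebraicClosure ℚ)))) * θI + (8 : 𝓞 ↥(IntermediateField.adjoin ℚ ({β} : Set (AlgebraicClosure ℚ)))) * δI), by push_cast; linear_combination ((36 : 𝓞 ↥(IntermediateField.adjoin ℚ ({β} : Set (AlgebraicClosure ℚ))))) * hX2 + ((-16 : 𝓞 ↥(IntermediateField.adjoin ℚ ({β} : Set (AlgebraicClosure ℚ))))) * hXY + ((0 : 𝓞 ↥(IntermediateField.adjoin ℚ ({β} : Set (AlgebraicClosure ℚ))))) * hY2⟩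
      · exact Ideal.mem_span_singleton'.mpr ⟨((-4 : 𝓞 ↥(IntermediateField.adjoin ℚ ({β} : Set (AlgebraicClosure ℚ)))) + (9 : 𝓞 ↥(IntermediateField.adjoin ℚ ({β} : Set (AlgebraicClosure ℚ)))) * θI + (-4 : 𝓞 ↥(IntermediateField.adjoin ℚ ({β} : Set (AlgebraicClosure ℚ)))) * δI), by push_cast; linear_combination ((-18 : 𝓞 ↥(IntermediateField.adjoin ℚ ({β} : Set (AlgebraicClosure ℚ))))) * hX2 + ((8 : 𝓞 ↥(IntermediateField.adjoin ℚ ({β} : Set (AlgebraicClosure ℚ))))) * hXY + ((0 : 𝓞 ↥(IntermediateField.adjoin ℚ ({β} : Set (AlgebraicClosure ℚ))))) * hY2⟩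
    · rw [Ideal.span_singleton_le_iff_mem, Ideal.mem_span_pair]
      exact ⟨((-1 : 𝓞 ↥(IntermediateField.adjoin ℚ ({β} : Set (AlgebraicClosure ℚ)))) + (0 : 𝓞 ↥(IntermediateField.adjoin ℚ ({β} : Set (AlgebraicClosure ℚ)))) * θI + (0 : 𝓞 ↥(IntermediateField.adjoin ℚ ({β} : Set (AlgebraicClosure ℚ)))) * δI), ((-2 : 𝓞 ↥(IntermediateField.adjoin ℚ ({β} : Set (AlgebraicClosure ℚ)))) + (0 : 𝓞 ↥(IntermediateField.adjoin ℚ ({β} : Set (AlgebraicClosure ℚ)))) * θI + (0 : 𝓞 ↥(IntermediateField.adjoin ℚ ({β} : Set (AlgebraicClosure ℚ)))) * δI), by push_cast; linear_combination ((0 : 𝓞 ↥(IntermediateField.adjoin ℚ ({β} : Set (AlgebraicClosure ℚ))))) * hX2 + ((0 : 𝓞 ↥(IntermediateField.adjoin ℚ ({β} : Set (AlgebraicClosure ℚ))))) * hXY + ((0 : 𝓞 ↥(IntermediateField.adjoin ℚ ({β} : Set (AlgebraicClosure ℚ))))) * hY2⟩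
  rw [← hspan, ← hker]
  exact ker_zmod_isMaximal ψ

/-! ## §2 The power-membership certificates `y ∈ σ^i(𝔮)^{eᵢ}` (two-term form `y = λ·q₀^{eᵢ} + μ·(σ^i s₂ − t)^{eᵢ}`; the trivial ones, `eᵢ = 0`, are inlined in §3) -/

/-- Membership certificate `y ∈ σ^0(𝔮)^3` (`𝔮 = (q₀, s₂ − 8)`): `y = λ·q₀^3 + μ·(σ^0s₂ − 8)^3` in `𝓞_K[s₁,s₂]` (`(q₀^3, (σ^0s₂ − 8)^3) = σ^0(𝔮)^3`; `λ, μ` by lattice reduction on the seat), valid in every commutative ring with the tower relations and the multiplication table of `CubicDisc1559`. [cite: Cohen1993, §4.7] [cite: NeukirchANT1999, Ch. I §3 (3.3)] -/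
theorem mem_sigma0_n10913 {β : AlgebraicClosure ℚ} (hβ : aeval β ((⟨1, 1, 1, -244, -1572⟩ : WeierstrassCurve ℤ).baseChange ℚ).twoTorsionPolynomial.toPoly = 0) :
    haveI : FiniteDimensional ℚ ↥(IntermediateField.adjoin ℚ ({β} : Set (AlgebraicClosure ℚ))) := IntermediateField.adjoin.finiteDimensional ((AlgebraicClosure.isAlgebraic ℚ).isAlgebraic β).isIntegral
    haveI : NumberField ↥(IntermediateField.adjoin ℚ ({β} : Set (AlgebraicClosure ℚ))) := NumberField.mk
    ∀ (R : Type) [CommRing R] (φ : 𝓞 ↥(IntermediateField.adjoin ℚ ({β} : Set (AlgebraicClosure ℚ))) →+* R) (S₁ S₂ : R), S₁ ^ 2 = 2 → S₂ ^ 2 = 2 + S₁ →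
      ∃ c : ℕ → R, φ ((31 : 𝓞 ↥(IntermediateField.adjoin ℚ ({β} : Set (AlgebraicClosure ℚ)))) + (-12 : 𝓞 ↥(IntermediateField.adjoin ℚ ({β} : Set (AlgebraicClosure ℚ)))) * MonicCubic.thetaInt (aeval_theta_n10913 hβ) + (2 : 𝓞 ↥(IntermediateField.adjoin ℚ ({β} : Set (AlgebraicClosure ℚ)))) * MonicCubic.thetaInt (CubicDisc1559.delta_root (aeval_theta_n10913 hβ))) + φ ((-13 : 𝓞 ↥(IntermediateField.adjoin ℚ ({β} : Set (AlgebraicClosure ℚ)))) + (7 : 𝓞 ↥(IntermediateField.adjoin ℚ ({β} : Set (AlgebraicClosure ℚ)))) * MonicCubic.thetaInt (aeval_theta_n10913 hβ) + (-2 : 𝓞 ↥(IntermediateField.adjoin ℚ ({β} : Set (AlgebraicClosure ℚ)))) * MonicCubic.thetaInt (CubicDisc1559.delta_root (aeval_theta_n10913 hβ))) * S₁ + (φ ((34 : 𝓞 ↥(IntermediateField.adjoin ℚ ({β} : Set (AlgebraicClosure ℚ)))) + (-16 : 𝓞 ↥(IntermediateField.adjoin ℚ ({β} : Set (AlgebraicClosure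 ℚ)))) * MonicCubic.thetaInt (aeval_theta_n10913 hβ) + (4 : 𝓞 ↥(IntermediateField.adjoin ℚ ({β} : Set (AlgebraicClosure ℚ)))) * MonicCubic.thetaInt (CubicDisc1559.delta_root (aeval_theta_n10913 hβ))) + φ ((-20 : 𝓞 ↥(IntermediateField.adjoin ℚ ({β} : Set (AlgebraicClosure ℚ)))) + (12 : 𝓞 ↥(IntermediateField.adjoin ℚ ({β} : Set (AlgebraicClosure ℚ)))) * MonicCubic.thetaInt (aeval_theta_n10913 hβ) + (-3 : 𝓞 ↥(IntermediateField.adjoin ℚ ({β} : Set (AlgebraicClosure ℚ)))) * MonicCubic.thetaInt (CubicDisc1559.delta_root (aeval_theta_n10913 hβ))) * S₁) * S₂ =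
        ∑ k ∈ Finset.range (3 + 1), c k * φ ((7 : 𝓞 ↥(IntermediateField.adjoin ℚ ({β} : Set (AlgebraicClosure ℚ)))) + (-2 : 𝓞 ↥(IntermediateField.adjoin ℚ ({β} : Set (AlgebraicClosure ℚ)))) * MonicCubic.thetaInt (aeval_theta_n10913 hβ) + (0 : 𝓞 ↥(IntermediateField.adjoin ℚ ({β} : Set (AlgebraicClosure ℚ)))) * MonicCubic.thetaInt (CubicDisc1559.delta_root (aeval_theta_n10913 hβ))) ^ (3 - k) * (S₂ - ((8 : ℤ) : R)) ^ k := by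
  haveI : FiniteDimensional ℚ ↥(IntermediateField.adjoin ℚ ({β} : Set (AlgebraicClosure ℚ))) := IntermediateField.adjoin.finiteDimensional ((AlgebraicClosure.isAlgebraic ℚ).isAlgebraic β).isIntegral
  haveI : NumberField ↥(IntermediateField.adjoin ℚ ({β} : Set (AlgebraicClosure ℚ))) := NumberField.mk
  intro R _ φ S₁ S₂ hS₁ hS₂
  have hθ := aeval_theta_n10913 hβ
  set θI : 𝓞 ↥(IntermediateField.adjoin ℚ ({β} : Set (AlgebraicClosure ℚ))) := MonicCubic.thetaInt hθ with hθI
  set δI : 𝓞 ↥(IntermediateField.adjoin ℚ ({β} : Set (AlgebraicClosure ℚ))) := MonicCubic.thetaInt (CubicDisc1559.delta_root hθ) with hδI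
  obtain ⟨hX2, hXY, hY2⟩ := CubicDisc1559.mul_table hθ
  rw [← hθI, ← hδI] at hX2 hXY hY2
  have hX2' := congrArg φ hX2
  have hXY' := congrArg φ hXY
  have hY2' := congrArg φ hY2
  simp only [map_add, map_mul, map_pow, map_sub, map_neg, map_ofNat] at hX2' hXY' hY2'
  refine ⟨fun k => (((1 - k : ℕ) : R)) * ((97 + (-20) * φ θI + (-120) * φ δI) + (11 + (-43) * φ θI + (-48) * φ δI) * S₁ + (((-128) + 94 * φ θI + 12 * φ δI) + ((-62) + 7 * φ θI + 11 * φ δI) * S₁) * S₂) + (((k - 2 : ℕ) : R)) * (((-20) + 91 * φ θI + (-36) * φ δI) + ((-51) + 66 * φ θI + (-24) * φ δI) * S₁ + (((-136) + 71 * φ θI + (-17) * φ δI) + ((-63) + 38 * φ θI + (-11) * φ δI) * S₁) * S₂), ?_⟩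
  simp only [Finset.sum_range_succ, Finset.sum_range_zero, zero_add, map_add, map_mul, map_neg, map_ofNat, map_zero]
  linear_combination (11260 + (-1461) * S₂ + 63 * S₁ + 1597 * φ δI + (-240) * S₂ * φ δI + 11 * S₁ * φ δI + (-5935) * φ θI + 846 * S₂ * φ θI + (-38) * S₁ * φ θI) * hS₁ + (25904 + (-3244) * S₂ + 136 * S₂ ^ 2 + 11134 * S₁ + (-1461) * S₁ * S₂ + 63 * S₁ * S₂ ^ 2 + 63 * S₁ ^ 2 + 2434 * φ δI + (-372) * S₂ * φ δI + 17 * S₂ ^ 2 * φ δI + 1575 * S₁ * φ δI + (-240) * S₁ * S₂ * φ δI + 11 * S₁ * S₂ ^ 2 * φ δI + 11 * S₁ ^ 2 * φ δI + (-11590) * φ θI + 1613 * S₂ * φ θI + (-71) * S₂ ^ 2 * φ θI + (-5859) * S₁ * φ θI + 846 * S₁ * S₂ * φ θI + (-38) * S₁ * S₂ ^ 2 * φ θI + (-38) * S₁ ^ 2 * φ θI) * hS₂ + ((-16644) + 48060 * S₂ + (-17610) * S₁ + 8406 * S₁ * S₂ + 10720 * φ δI + 400 * S₂ * φ δI + 3728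 * S₁ * φ δI + (-900) * S₁ * S₂ * φ δI + 2616 * φ θI + (-9672) * S₂ * φ θI + 4044 * S₁ * φ θI + (-1140) * S₁ * S₂ * φ θI + (-960) * φ θI * φ δI + 96 * S₂ * φ θI * φ δI + (-384) * S₁ * φ θI * φ δI + 88 * S₁ * S₂ * φ θI * φ δI + (-160) * φ θI ^ 2 + 752 * S₂ * φ θI ^ 2 + (-344) * S₁ * φ θI ^ 2 + 56 * S₁ * S₂ * φ θI ^ 2) * hX2' + ((-19648) + (-18328) * S₂ + (-1304) * S₁ + (-82) * S₁ * S₂ + (-1920) * φ δI + 192 * S₂ * φ δI + (-768) * S₁ * φ δI + 176 * S₁ * S₂ * φ δI) * hXY' + (6080 + 2336 * S₂ + 1312 * S₁ + (-392) * S₁ * S₂) * hY2'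

/-- Membership certificate `y ∈ σ^1(𝔮)^1` (`𝔮 = (q₀, s₂ − 8)`): `y = λ·q₀^1 + μ·(σ^1s₂ − 8)^1` in `𝓞_K[s₁,s₂]` (`(q₀^1, (σ^1s₂ − 8)^1) = σ^1(𝔮)^1`; `λ, μ` by lattice reduction on the seat), valid in every commutative ring with the tower relations and the multiplication table of `CubicDisc1559`. [cite: Cohen1993, §4.7] [cite: NeukirchANT1999, Ch. I §3 (3.3)] -/
theorem mem_sigma1_n10913 {β : AlgebraicClosure ℚ} (hβ : aeval β ((⟨1, 1, 1, -244, -1572⟩ : WeierstrassCurve ℤ).baseChange ℚ).twoTorsionPolynomial.toPoly = 0) :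
    haveI : FiniteDimensional ℚ ↥(IntermediateField.adjoin ℚ ({β} : Set (AlgebraicClosure ℚ))) := IntermediateField.adjoin.finiteDimensional ((AlgebraicClosure.isAlgebraic ℚ).isAlgebraic β).isIntegral
    haveI : NumberField ↥(IntermediateField.adjoin ℚ ({β} : Set (AlgebraicClosure ℚ))) := NumberField.mk
    ∀ (R : Type) [CommRing R] (φ : 𝓞 ↥(IntermediateField.adjoin ℚ ({β} : Set (AlgebraicClosure ℚ))) →+* R) (S₁ S₂ : R), S₁ ^ 2 = 2 → S₂ ^ 2 = 2 + S₁ →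
      ∃ c : ℕ → R, φ ((31 : 𝓞 ↥(IntermediateField.adjoin ℚ ({β} : Set (AlgebraicClosure ℚ)))) + (-12 : 𝓞 ↥(IntermediateField.adjoin ℚ ({β} : Set (AlgebraicClosure ℚ)))) * MonicCubic.thetaInt (aeval_theta_n10913 hβ) + (2 : 𝓞 ↥(IntermediateField.adjoin ℚ ({β} : Set (AlgebraicClosure ℚ)))) * MonicCubic.thetaInt (CubicDisc1559.delta_root (aeval_theta_n10913 hβ))) + φ ((-13 : 𝓞 ↥(IntermediateField.adjoin ℚ ({β} : Set (AlgebraicClosure ℚ)))) + (7 : 𝓞 ↥(IntermediateField.adjoin ℚ ({β} : Set (AlgebraicClosure ℚ)))) * MonicCubic.thetaInt (aeval_theta_n10913 hβ) + (-2 : 𝓞 ↥(IntermediateField.adjoin ℚ ({β} : Set (AlgebraicClosure ℚ)))) * MonicCubic.thetaInt (CubicDisc1559.delta_root (aeval_theta_n10913 hβ))) * S₁ + (φ ((34 : 𝓞 ↥(IntermediateField.adjoin ℚ ({β} : Set (AlgebraicClosure ℚ)))) + (-16 : 𝓞 ↥(IntermediateField.adjoin ℚ ({β} : Set (AlgebraicClosure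 ℚ)))) * MonicCubic.thetaInt (aeval_theta_n10913 hβ) + (4 : 𝓞 ↥(IntermediateField.adjoin ℚ ({β} : Set (AlgebraicClosure ℚ)))) * MonicCubic.thetaInt (CubicDisc1559.delta_root (aeval_theta_n10913 hβ))) + φ ((-20 : 𝓞 ↥(IntermediateField.adjoin ℚ ({β} : Set (AlgebraicClosure ℚ)))) + (12 : 𝓞 ↥(IntermediateField.adjoin ℚ ({β} : Set (AlgebraicClosure ℚ)))) * MonicCubic.thetaInt (aeval_theta_n10913 hβ) + (-3 : 𝓞 ↥(IntermediateField.adjoin ℚ ({β} : Set (AlgebraicClosure ℚ)))) * MonicCubic.thetaInt (CubicDisc1559.delta_root (aeval_theta_n10913 hβ))) * S₁) * S₂ =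
        ∑ k ∈ Finset.range (1 + 1), c k * φ ((7 : 𝓞 ↥(IntermediateField.adjoin ℚ ({β} : Set (AlgebraicClosure ℚ)))) + (-2 : 𝓞 ↥(IntermediateField.adjoin ℚ ({β} : Set (AlgebraicClosure ℚ)))) * MonicCubic.thetaInt (aeval_theta_n10913 hβ) + (0 : 𝓞 ↥(IntermediateField.adjoin ℚ ({β} : Set (AlgebraicClosure ℚ)))) * MonicCubic.thetaInt (CubicDisc1559.delta_root (aeval_theta_n10913 hβ))) ^ (1 - k) * (S₁ * S₂ - S₂ - ((8 : ℤ) : R)) ^ k := by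
  haveI : FiniteDimensional ℚ ↥(IntermediateField.adjoin ℚ ({β} : Set (AlgebraicClosure ℚ))) := IntermediateField.adjoin.finiteDimensional ((AlgebraicClosure.isAlgebraic ℚ).isAlgebraic β).isIntegral
  haveI : NumberField ↥(IntermediateField.adjoin ℚ ({β} : Set (AlgebraicClosure ℚ))) := NumberField.mk
  intro R _ φ S₁ S₂ hS₁ hS₂
  have hθ := aeval_theta_n10913 hβ
  set θI : 𝓞 ↥(IntermediateField.adjoin ℚ ({β} : Set (AlgebraicClosure ℚ))) := MonicCubic.thetaInt hθ with hθI
  set δI : 𝓞 ↥(IntermediateField.adjoin ℚ ({β} : Set (AlgebraicClosure ℚ))) := MonicCubic.thetaInt (CubicDisc1559.delta_root hθ) with hδI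
  obtain ⟨hX2, hXY, hY2⟩ := CubicDisc1559.mul_table hθ
  rw [← hθI, ← hδI] at hX2 hXY hY2
  have hX2' := congrArg φ hX2
  have hXY' := congrArg φ hXY
  have hY2' := congrArg φ hY2
  simp only [map_add, map_mul, map_pow, map_sub, map_neg, map_ofNat] at hX2' hXY' hY2'
  refine ⟨fun k => (((1 - k : ℕ) : R)) * ((3 + 0 * φ θI + 0 * φ δI) + (2 + 1 * φ θI + 0 * φ δI) * S₁ + ((5 + 4 * φ θI + (-4) * φ δI) + (0 + 1 * φ θI + (-1) * φ δI) * S₁) * S₂) + ((k : ℕ) : R) * (((-1) + 0 * φ θI + 0 * φ δI) + (3 + (-1) * φ θI + 0 * φ δI) * S₁ + (((-3) + (-6) * φ θI + 2 * φ δI) + (1 + (-3) * φ θI + 1 * φ δI) * S₁) * S₂), ?_⟩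
  simp only [Finset.sum_range_succ, Finset.sum_range_zero, zero_add, Nat.cast_zero, Nat.cast_one, map_add, map_mul, map_neg, map_ofNat, map_zero]
  linear_combination (2 + (-3) * S₂ + (-1) * S₁ + (-3) * φ δI + (-1) * S₁ * φ δI + 9 * φ θI + 1 * S₂ * φ θI + 3 * S₁ * φ θI) * hS₁ + ((-3) + 4 * S₁ + (-1) * S₁ ^ 2 + 2 * φ δI + (-1) * S₁ * φ δI + (-1) * S₁ ^ 2 * φ δI + (-6) * φ θI + 3 * S₁ * φ θI + 3 * S₁ ^ 2 * φ θI) * hS₂ + (8 * S₂ + 2 * S₁ + 2 * S₁ * S₂) * hX2' + ((-8) * S₂ + (-2) * S₁ * S₂) * hXY' + (0) * hY2'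

/-! ## §3 ★★★ The general relation row at layer two on the split stratum: `rank₂ ≤ 1`, `μ₂ = 0`, `λ₂ ≤ 1` — UNCONDITIONAL -/

set_option maxHeartbeats 4000000 in
/-- ★★★ **`rank₂ Cl(K_m) ≤ 1 ∀ m`, `μ₂ = 0`, `λ₂ ≤ 1` — UNCONDITIONAL — for every cyclotomic `ℤ₂`-extension of the cubic `2`-torsion field of `⟨1, 1, 1, -244, -1572⟩`**
(`N = 10913`, split stratum, cubic field `−1559`): the split-stratum GENERAL layer-two relation door in coordinates with the datum `q₀ = 7 - 2 * θ` (norm `113`), `t = 8`,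
exponents `e = (3, 1, 0, 0)` (`Σ eᵢXⁱ = (X−1)^1 + 2g`), `y` (blocks on `1, s₁, s₂, s₁s₂`), `N(y) = ε_y q₀^4`, memberships and coprimality witnesses; the unit
`ε = 89 + 176 * θ + 66 * δ` is `≡ ±1 (mod 𝔭₁³)` and `≡ ±3 (mod 𝔭'³)`.
[cite: Washington1997, §13.3 Lemmas 13.15, 13.18, Prop. 13.22–13.23] [cite: Lang1990, Ch. 13 §4 Lemma 4.1] [cite: Fukuda1994, Thm. 1, p. 264] [cite: Cohen1993, §6.5]
[cite: LMFDB, number field 3.1.1559.1] -/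
theorem classGroupPRank_le_and_mu_lambda_cubicField_n10913 {β : AlgebraicClosure ℚ} (hβ : aeval β ((⟨1, 1, 1, -244, -1572⟩ : WeierstrassCurve ℤ).baseChange ℚ).twoTorsionPolynomial.toPoly = 0)
    (κP : ZpExtension ↥(IntermediateField.adjoin ℚ ({β} : Set (AlgebraicClosure ℚ))) 2) (hκP : κP.IsCyclotomic) :
    (∀ m, classGroupPRank κP m ≤ 1) ∧ ClassicalMuVanishes κP ∧ classicalLambda κP ≤ 1 := by
  haveI := isElliptic_n10913
  haveI := isGloballyMinimal_n10913
  haveI : FiniteDimensional ℚ ↥(IntermediateField.adjoin ℚ ({β} : Set (AlgebraicClosure ℚ))) := IntermediateField.adjoin.finiteDimensional ((AlgebraicClosure.isAlgebraic ℚ).isAlgebraic β).isIntegral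
  haveI : NumberField ↥(IntermediateField.adjoin ℚ ({β} : Set (AlgebraicClosure ℚ))) := NumberField.mk
  have hord : IsOrdinaryAt ((⟨1, 1, 1, -244, -1572⟩ : WeierstrassCurve ℤ).baseChange ℚ) 2 := goodOrd_two_n10913
  have ht := not_hasRationalTwoTorsionX_n10913
  have hθ := aeval_theta_n10913 hβ
  have h3 := finrank_cubicField_n10913 hβ
  have hd : ¬ (2 : ℤ) ∣ NumberField.discr ↥(IntermediateField.adjoin ℚ ({β} : Set (AlgebraicClosure ℚ))) := by
    rw [CubicDisc1559.discr_eq h3 hθ]; norm_num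
  obtain ⟨ψ, hψ⟩ := exists_residueHom_q hβ
  obtain ⟨χ, hχ⟩ := exists_residueHom_chi hβ
  have hmax := isMaximal_span_q0_n10913 hβ
  have hN1 := absNorm_span_pi1_n10913 hβ
  have hN' := absNorm_span_pip_n10913 hβ
  set θI : 𝓞 ↥(IntermediateField.adjoin ℚ ({β} : Set (AlgebraicClosure ℚ))) := MonicCubic.thetaInt hθ with hθI
  set δI : 𝓞 ↥(IntermediateField.adjoin ℚ ({β} : Set (AlgebraicClosure ℚ))) := MonicCubic.thetaInt (CubicDisc1559.delta_root hθ) with hδI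
  obtain ⟨hX2, hXY, hY2⟩ := CubicDisc1559.mul_table hθ
  have hden := CubicDisc1559.den_delta hθ
  rw [← hθI, ← hδI] at hX2 hXY hY2 hden
  have hm0 := mem_sigma0_n10913 hβ
  have hm1 := mem_sigma1_n10913 hβ
  have hm2 : ∀ (R : Type) [CommRing R] (φ : 𝓞 ↥(IntermediateField.adjoin ℚ ({β} : Set (AlgebraicClosure ℚ))) →+* R) (S₁ S₂ : R), S₁ ^ 2 = 2 → S₂ ^ 2 = 2 + S₁ →
      ∃ c : ℕ → R, φ ((31 : 𝓞 ↥(IntermediateField.adjoin ℚ ({β} : Set (AlgebraicClosure ℚ)))) + (-12 : 𝓞 ↥(IntermediateField.adjoin ℚ ({β} : Set (AlgebraicClosure ℚ)))) * θI + (2 : 𝓞 ↥(IntermediateField.adjoin ℚ ({β} : Set (AlgebraicClosure ℚ)))) * δI) + φ ((-13 : 𝓞 ↥(IntermediateField.adjoin ℚ ({β} : Set (AlgebraicClosure ℚ)))) + (7 : 𝓞 ↥(IntermediateField.adjoin ℚ ({β} : Set (AlgebraicClosure ℚ)))) * θI + (-2 : 𝓞 ↥(IntermediateField.adjoin ℚ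 ({β} : Set (AlgebraicClosure ℚ)))) * δI) * S₁ + (φ ((34 : 𝓞 ↥(IntermediateField.adjoin ℚ ({β} : Set (AlgebraicClosure ℚ)))) + (-16 : 𝓞 ↥(IntermediateField.adjoin ℚ ({β} : Set (AlgebraicClosure ℚ)))) * θI + (4 : 𝓞 ↥(IntermediateField.adjoin ℚ ({β} : Set (AlgebraicClosure ℚ)))) * δI) + φ ((-20 : 𝓞 ↥(IntermediateField.adjoin ℚ ({β} : Set (AlgebraicClosure ℚ)))) + (12 : 𝓞 ↥(IntermediateField.adjoin ℚ ({β} : Set (AlgebraicClosure ℚ)))) * θI + (-3 : 𝓞 ↥(IntermediateField.adjoin ℚ ({β} : Set (AlgebraicClosure ℚ)))) * δI) * S₁) * S₂ = ∑ k ∈ Finset.range (0 + 1), c k * φ ((7 : 𝓞 ↥(IntermediateField.adjoin ℚ ({β} : Set (AlgebraicClosure ℚ)))) + (-2 : 𝓞 ↥(IntermediateField.adjoin ℚ ({β} : Set (AlgebraicClosure ℚ)))) * θI + (0 : 𝓞 ↥(IntermediateField.adjoin ℚ ({β} : Set (AlgebraicClosure ℚ)))) * δI) ^ (0 - k) * (-S₂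 - ((8 : ℤ) : R)) ^ k :=
    fun R _ φ S₁ S₂ _ _ => ⟨fun _ => φ ((31 : 𝓞 ↥(IntermediateField.adjoin ℚ ({β} : Set (AlgebraicClosure ℚ)))) + (-12 : 𝓞 ↥(IntermediateField.adjoin ℚ ({β} : Set (AlgebraicClosure ℚ)))) * θI + (2 : 𝓞 ↥(IntermediateField.adjoin ℚ ({β} : Set (AlgebraicClosure ℚ)))) * δI) + φ ((-13 : 𝓞 ↥(IntermediateField.adjoin ℚ ({β} : Set (AlgebraicClosure ℚ)))) + (7 : 𝓞 ↥(IntermediateField.adjoin ℚ ({β} : Set (AlgebraicClosure ℚ)))) * θI + (-2 : 𝓞 ↥(IntermediateField.adjoin ℚ ({β} : Set (AlgebraicClosure ℚ)))) * δI) * S₁ + (φ ((34 : 𝓞 ↥(IntermediateField.adjoin ℚ ({β} : Set (AlgebraicClosure ℚ)))) + (-16 : 𝓞 ↥(IntermediateField.adjoin ℚ ({β} : Set (AlgebraicClosure ℚ)))) * θI + (4 : 𝓞 ↥(IntermediateField.adjoin ℚ ({β} : Set (AlgebraicClosure ℚ)))) * δI) + φ ((-20 : 𝓞 ↥(IntermediateField.adjoin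 ℚ ({β} : Set (AlgebraicClosure ℚ)))) + (12 : 𝓞 ↥(IntermediateField.adjoin ℚ ({β} : Set (AlgebraicClosure ℚ)))) * θI + (-3 : 𝓞 ↥(IntermediateField.adjoin ℚ ({β} : Set (AlgebraicClosure ℚ)))) * δI) * S₁) * S₂, by simp⟩
  have hm3 : ∀ (R : Type) [CommRing R] (φ : 𝓞 ↥(IntermediateField.adjoin ℚ ({β} : Set (AlgebraicClosure ℚ))) →+* R) (S₁ S₂ : R), S₁ ^ 2 = 2 → S₂ ^ 2 = 2 + S₁ →
      ∃ c : ℕ → R, φ ((31 : 𝓞 ↥(IntermediateField.adjoin ℚ ({β} : Set (AlgebraicClosure ℚ)))) + (-12 : 𝓞 ↥(IntermediateField.adjoin ℚ ({β} : Set (AlgebraicClosure ℚ)))) * θI + (2 : 𝓞 ↥(IntermediateField.adjoin ℚ ({β} : Set (AlgebraicClosure ℚ)))) * δI) + φ ((-13 : 𝓞 ↥(IntermediateField.adjoin ℚ ({β} : Set (AlgebraicClosure ℚ)))) + (7 : 𝓞 ↥(IntermediateField.adjoin ℚ ({β} : Set (AlgebraicClosure ℚ)))) * θI + (-2 : 𝓞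 ↥(IntermediateField.adjoin ℚ ({β} : Set (AlgebraicClosure ℚ)))) * δI) * S₁ + (φ ((34 : 𝓞 ↥(IntermediateField.adjoin ℚ ({β} : Set (AlgebraicClosure ℚ)))) + (-16 : 𝓞 ↥(IntermediateField.adjoin ℚ ({β} : Set (AlgebraicClosure ℚ)))) * θI + (4 : 𝓞 ↥(IntermediateField.adjoin ℚ ({β} : Set (AlgebraicClosure ℚ)))) * δI) + φ ((-20 : 𝓞 ↥(IntermediateField.adjoin ℚ ({β} : Set (AlgebraicClosure ℚ)))) + (12 : 𝓞 ↥(IntermediateField.adjoin ℚ ({β} : Set (AlgebraicClosure ℚ)))) * θI + (-3 : 𝓞 ↥(IntermediateField.adjoin ℚ ({β} : Set (AlgebraicClosure ℚ)))) * δI) * S₁) * S₂ = ∑ k ∈ Finset.range (0 + 1), c k * φ ((7 : 𝓞 ↥(IntermediateField.adjoin ℚ ({β} : Set (AlgebraicClosure ℚ)))) + (-2 : 𝓞 ↥(IntermediateField.adjoin ℚ ({β} : Set (AlgebraicClosure ℚ)))) * θI + (0 : 𝓞 ↥(IntermediateField.adjoin ℚ ({β} : Set (AlgebraicClosure ℚ))))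 * δI) ^ (0 - k) * (S₂ - S₁ * S₂ - ((8 : ℤ) : R)) ^ k :=
    fun R _ φ S₁ S₂ _ _ => ⟨fun _ => φ ((31 : 𝓞 ↥(IntermediateField.adjoin ℚ ({β} : Set (AlgebraicClosure ℚ)))) + (-12 : 𝓞 ↥(IntermediateField.adjoin ℚ ({β} : Set (AlgebraicClosure ℚ)))) * θI + (2 : 𝓞 ↥(IntermediateField.adjoin ℚ ({β} : Set (AlgebraicClosure ℚ)))) * δI) + φ ((-13 : 𝓞 ↥(IntermediateField.adjoin ℚ ({β} : Set (AlgebraicClosure ℚ)))) + (7 : 𝓞 ↥(IntermediateField.adjoin ℚ ({β} : Set (AlgebraicClosure ℚ)))) * θI + (-2 : 𝓞 ↥(IntermediateField.adjoin ℚ ({β} : Set (AlgebraicClosure ℚ)))) * δI) * S₁ + (φ ((34 : 𝓞 ↥(IntermediateField.adjoin ℚ ({β} : Set (AlgebraicClosure ℚ)))) + (-16 : 𝓞 ↥(IntermediateField.adjoin ℚ ({β} : Set (AlgebraicClosure ℚ)))) * θI + (4 : 𝓞 ↥(IntermediateField.adjoin ℚ ({β} : Set (AlgebraicClosure ℚ))))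 * δI) + φ ((-20 : 𝓞 ↥(IntermediateField.adjoin ℚ ({β} : Set (AlgebraicClosure ℚ)))) + (12 : 𝓞 ↥(IntermediateField.adjoin ℚ ({β} : Set (AlgebraicClosure ℚ)))) * θI + (-3 : 𝓞 ↥(IntermediateField.adjoin ℚ ({β} : Set (AlgebraicClosure ℚ)))) * δI) * S₁) * S₂, by simp⟩
  -- residues of `δ`
  have hψδ : ψ δI = (22 : ZMod 113) := by
    have h := congrArg ψ hden
    simp only [map_mul, map_add, map_pow, map_one, map_ofNat, hψ] at h
    have h9 : (57 : ZMod 113) * 2 = 1 := by decide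
    calc ψ δI = ((57 : ZMod 113) * 2) * ψ δI := by rw [h9, one_mul]
      _ = (57 : ZMod 113) * (2 * ψ δI) := by ring
      _ = (22 : ZMod 113) := by rw [h]; decide
  have hχδ : χ δI = (15 : ZMod 17) := by
    have h := congrArg χ hden
    simp only [map_mul, map_add, map_pow, map_one, map_ofNat, hχ] at h
    have h9 : (9 : ZMod 17) * 2 = 1 := by decide
    calc χ δI = ((9 : ZMod 17) * 2) * χ δI := by rw [h9, one_mul]
      _ = (9 : ZMod 17) * (2 * χ δI) := by ring
      _ = (15 : ZMod 17) := by rw [h]; decide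
  -- the unit `ε` and its inverse; `±ε` non-squares (at `χ`)
  have hεmul : ((89 : 𝓞 ↥(IntermediateField.adjoin ℚ ({β} : Set (AlgebraicClosure ℚ)))) + (176 : 𝓞 ↥(IntermediateField.adjoin ℚ ({β} : Set (AlgebraicClosure ℚ)))) * θI + (66 : 𝓞 ↥(IntermediateField.adjoin ℚ ({β} : Set (AlgebraicClosure ℚ)))) * δI) * ((1816849 : 𝓞 ↥(IntermediateField.adjoin ℚ ({β} : Set (AlgebraicClosure ℚ)))) + (-882024 : 𝓞 ↥(IntermediateField.adjoin ℚ ({β} : Set (AlgebraicClosure ℚ)))) * θI + (208538 : 𝓞 ↥(IntermediateField.adjoin ℚ ({β} : Set (AlgebraicClosure ℚ)))) * δI) = 1 := by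
    linear_combination ((-155236224 : 𝓞 ↥(IntermediateField.adjoin ℚ ({β} : Set (AlgebraicClosure ℚ))))) * hX2 + ((-21510896 : 𝓞 ↥(IntermediateField.adjoin ℚ ({β} : Set (AlgebraicClosure ℚ))))) * hXY + ((13763508 : 𝓞 ↥(IntermediateField.adjoin ℚ ({β} : Set (AlgebraicClosure ℚ))))) * hY2
  have hχε : χ ((89 : 𝓞 ↥(IntermediateField.adjoin ℚ ({β} : Set (AlgebraicClosure ℚ)))) + (176 : 𝓞 ↥(IntermediateField.adjoin ℚ ({β} : Set (AlgebraicClosure ℚ)))) * θI + (66 : 𝓞 ↥(IntermediateField.adjoin ℚ ({β} : Set (AlgebraicClosure ℚ)))) * δI) = (6 : ZMod 17) := by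
    simp only [map_add, map_mul, map_ofNat, hχ, hχδ]; push_cast; decide
  have hnsq : ∀ z : (𝓞 ↥(IntermediateField.adjoin ℚ ({β} : Set (AlgebraicClosure ℚ))))ˣ, Units.mkOfMulEqOne _ _ hεmul ≠ z ^ 2 ∧ Units.mkOfMulEqOne _ _ hεmul ≠ -z ^ 2 := by
    intro z
    refine ⟨fun h => ?_, fun h => ?_⟩
    · have h' := congrArg (fun w : (𝓞 ↥(IntermediateField.adjoin ℚ ({β} : Set (AlgebraicClosure ℚ))))ˣ => χ (w : 𝓞 ↥(IntermediateField.adjoin ℚ ({β} : Set (AlgebraicClosure ℚ))))) h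
      simp only [Units.val_mkOfMulEqOne, Units.val_pow_eq_pow_val, map_pow] at h'
      rw [hχε] at h'
      exact absurd h'.symm (by generalize χ (z : 𝓞 ↥(IntermediateField.adjoin ℚ ({β} : Set (AlgebraicClosure ℚ)))) = u; revert u; decide)
    · have h' := congrArg (fun w : (𝓞 ↥(IntermediateField.adjoin ℚ ({β} : Set (AlgebraicClosure ℚ))))ˣ => χ (w : 𝓞 ↥(IntermediateField.adjoin ℚ ({β} : Set (AlgebraicClosure ℚ))))) h
      simp only [Units.val_mkOfMulEqOne, Units.val_neg, Units.val_pow_eq_pow_val, map_neg, map_pow] at h'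
      rw [hχε] at h'
      exact absurd h'.symm (by generalize χ (z : 𝓞 ↥(IntermediateField.adjoin ℚ ({β} : Set (AlgebraicClosure ℚ)))) = u; revert u; decide)
  -- congruences at the dyadic primes
  have hε : (Units.mkOfMulEqOne _ _ hεmul : (𝓞 ↥(IntermediateField.adjoin ℚ ({β} : Set (AlgebraicClosure ℚ))))ˣ).val - 1 ∈ Ideal.span {((-1 : 𝓞 ↥(IntermediateField.adjoin ℚ ({β} : Set (AlgebraicClosure ℚ)))) + (-3 : 𝓞 ↥(IntermediateField.adjoin ℚ ({β} : Set (AlgebraicClosure ℚ)))) * θI + (3 : 𝓞 ↥(IntermediateField.adjoin ℚ ({β} : Set (AlgebraicClosure ℚ)))) * δI)} ^ 3 ∨ (Units.mkOfMulEqOne _ _ hεmul : (𝓞 ↥(IntermediateField.adjoin ℚ ({β} : Set (AlgebraicClosure ℚ))))ˣ).val + 1 ∈ Ideal.span {((-1 : 𝓞 ↥(IntermediateField.adjoin ℚ ({β} : Set (AlgebraicClosure ℚ)))) + (-3 : 𝓞 ↥(IntermediateField.adjoin ℚ ({β} : Set (AlgebraicClosure ℚ)))) * θI + (3 : 𝓞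 ↥(IntermediateField.adjoin ℚ ({β} : Set (AlgebraicClosure ℚ)))) * δI)} ^ 3 := by
    refine Or.inr ?_
    rw [Units.val_mkOfMulEqOne, Ideal.span_singleton_pow, Ideal.mem_span_singleton']
    exact ⟨((7175664 : 𝓞 ↥(IntermediateField.adjoin ℚ ({β} : Set (AlgebraicClosure ℚ)))) + (-3483563 : 𝓞 ↥(IntermediateField.adjoin ℚ ({β} : Set (AlgebraicClosure ℚ)))) * θI + (823623 : 𝓞 ↥(IntermediateField.adjoin ℚ ({β} : Set (AlgebraicClosure ℚ)))) * δI), by linear_combination ((31352067 : 𝓞 ↥(IntermediateField.adjoin ℚ ({β} : Set (AlgebraicClosure ℚ)))) + (863397387 : 𝓞 ↥(IntermediateField.adjoin ℚ ({β} : Set (AlgebraicClosure ℚ)))) * δI + (348882066 : 𝓞 ↥(IntermediateField.adjoin ℚ ({β} : Set (AlgebraicClosure ℚ)))) * δI ^ 2 + (-193742928 : 𝓞 ↥(IntermediateField.adjoin ℚ ({β} : Set (AlgebraicClosure ℚ)))) * θI + (-304406424 : 𝓞 ↥(IntermediateField.adjoin ℚ ({β} : Set (AlgebraicClosure ℚ))))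 * θI * δI + (94056201 : 𝓞 ↥(IntermediateField.adjoin ℚ ({β} : Set (AlgebraicClosure ℚ)))) * θI ^ 2) * hX2 + ((-95286366 : 𝓞 ↥(IntermediateField.adjoin ℚ ({β} : Set (AlgebraicClosure ℚ)))) + (-654865317 : 𝓞 ↥(IntermediateField.adjoin ℚ ({β} : Set (AlgebraicClosure ℚ)))) * δI + (-160769664 : 𝓞 ↥(IntermediateField.adjoin ℚ ({β} : Set (AlgebraicClosure ℚ)))) * δI ^ 2) * hXY + ((20776095 : 𝓞 ↥(IntermediateField.adjoin ℚ ({β} : Set (AlgebraicClosure ℚ)))) + (139057452 : 𝓞 ↥(IntermediateField.adjoin ℚ ({β} : Set (AlgebraicClosure ℚ)))) * δI + (22237821 : 𝓞 ↥(IntermediateField.adjoin ℚ ({β} : Set (AlgebraicClosure ℚ)))) * δI ^ 2) * hY2⟩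
  have hε' : (Units.mkOfMulEqOne _ _ hεmul : (𝓞 ↥(IntermediateField.adjoin ℚ ({β} : Set (AlgebraicClosure ℚ))))ˣ).val - 3 ∈ Ideal.span {((-35 : 𝓞 ↥(IntermediateField.adjoin ℚ ({β} : Set (AlgebraicClosure ℚ)))) + (17 : 𝓞 ↥(IntermediateField.adjoin ℚ ({β} : Set (AlgebraicClosure ℚ)))) * θI + (-4 : 𝓞 ↥(IntermediateField.adjoin ℚ ({β} : Set (AlgebraicClosure ℚ)))) * δI)} ^ 3 ∨ (Units.mkOfMulEqOne _ _ hεmul : (𝓞 ↥(IntermediateField.adjoin ℚ ({β} : Set (AlgebraicClosure ℚ))))ˣ).val + 3 ∈ Ideal.span {((-35 : 𝓞 ↥(IntermediateField.adjoin ℚ ({β} : Set (AlgebraicClosure ℚ)))) + (17 : 𝓞 ↥(IntermediateField.adjoin ℚ ({β} : Set (AlgebraicClosure ℚ)))) * θI + (-4 : 𝓞 ↥(IntermediateField.adjoin ℚ ({β} : Set (AlgebraicClosure ℚ)))) * δI)} ^ 3 := by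
    refine Or.inl ?_
    rw [Units.val_mkOfMulEqOne, Ideal.span_singleton_pow, Ideal.mem_span_singleton']
    exact ⟨((15998 : 𝓞 ↥(IntermediateField.adjoin ℚ ({β} : Set (AlgebraicClosure ℚ)))) + (42401 : 𝓞 ↥(IntermediateField.adjoin ℚ ({β} : Set (AlgebraicClosure ℚ)))) * θI + (-27940 : 𝓞 ↥(IntermediateField.adjoin ℚ ({β} : Set (AlgebraicClosure ℚ)))) * δI), by linear_combination ((3579919449 : 𝓞 ↥(IntermediateField.adjoin ℚ ({β} : Set (AlgebraicClosure ℚ)))) + (2098792630 : 𝓞 ↥(IntermediateField.adjoin ℚ ({β} : Set (AlgebraicClosure ℚ)))) * δI + (131495136 : 𝓞 ↥(IntermediateField.adjoin ℚ ({β} : Set (AlgebraicClosure ℚ)))) * δI ^ 2 + (-1416376284 : 𝓞 ↥(IntermediateField.adjoin ℚ ({β} : Set (AlgebraicClosure ℚ)))) * θI + (-284315888 : 𝓞 ↥(IntermediateField.adjoin ℚ ({β} : Set (AlgebraicClosure ℚ)))) * θI * δI + (208316113 : 𝓞 ↥(IntermediateField.adjoin ℚ ({β} : Set (AlgebraicClosure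 ℚ)))) * θI ^ 2) * hX2 + ((-3401351046 : 𝓞 ↥(IntermediateField.adjoin ℚ ({β} : Set (AlgebraicClosure ℚ)))) + (-958905040 : 𝓞 ↥(IntermediateField.adjoin ℚ ({β} : Set (AlgebraicClosure ℚ)))) * δI + (-25512704 : 𝓞 ↥(IntermediateField.adjoin ℚ ({β} : Set (AlgebraicClosure ℚ)))) * δI ^ 2) * hXY + ((717749436 : 𝓞 ↥(IntermediateField.adjoin ℚ ({β} : Set (AlgebraicClosure ℚ)))) + (149507968 : 𝓞 ↥(IntermediateField.adjoin ℚ ({β} : Set (AlgebraicClosure ℚ)))) * δI + (1788160 : 𝓞 ↥(IntermediateField.adjoin ℚ ({β} : Set (AlgebraicClosure ℚ)))) * δI ^ 2) * hY2⟩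
  have hπ : ((7 : 𝓞 ↥(IntermediateField.adjoin ℚ ({β} : Set (AlgebraicClosure ℚ)))) + (-2 : 𝓞 ↥(IntermediateField.adjoin ℚ ({β} : Set (AlgebraicClosure ℚ)))) * θI + (0 : 𝓞 ↥(IntermediateField.adjoin ℚ ({β} : Set (AlgebraicClosure ℚ)))) * δI) - 3 ∈ Ideal.span {((-1 : 𝓞 ↥(IntermediateField.adjoin ℚ ({β} : Set (AlgebraicClosure ℚ)))) + (-3 : 𝓞 ↥(IntermediateField.adjoin ℚ ({β} : Set (AlgebraicClosure ℚ)))) * θI + (3 : 𝓞 ↥(IntermediateField.adjoin ℚ ({β} : Set (AlgebraicClosure ℚ)))) * δI)} ^ 3 ∨ ((7 : 𝓞 ↥(IntermediateField.adjoin ℚ ({β} : Set (AlgebraicClosure ℚ)))) + (-2 : 𝓞 ↥(IntermediateField.adjoin ℚ ({β} : Set (AlgebraicClosure ℚ)))) * θI + (0 : 𝓞 ↥(IntermediateField.adjoin ℚ ({β} : Set (AlgebraicClosure ℚ)))) * δI) + 3 ∈ Ideal.span {((-1 : 𝓞 ↥(IntermediateField.adjoin ℚ ({β} : Set (AlgebraicClosure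 ℚ)))) + (-3 : 𝓞 ↥(IntermediateField.adjoin ℚ ({β} : Set (AlgebraicClosure ℚ)))) * θI + (3 : 𝓞 ↥(IntermediateField.adjoin ℚ ({β} : Set (AlgebraicClosure ℚ)))) * δI)} ^ 3 := by
    refine Or.inl ?_
    rw [Ideal.span_singleton_pow, Ideal.mem_span_singleton']
    exact ⟨((35291624 : 𝓞 ↥(IntermediateField.adjoin ℚ ({β} : Set (AlgebraicClosure ℚ)))) + (-17132992 : 𝓞 ↥(IntermediateField.adjoin ℚ ({β} : Set (AlgebraicClosure ℚ)))) * θI + (4050774 : 𝓞 ↥(IntermediateField.adjoin ℚ ({β} : Set (AlgebraicClosure ℚ)))) * δI), by linear_combination ((154196928 : 𝓞 ↥(IntermediateField.adjoin ℚ ({β} : Set (AlgebraicClosure ℚ)))) + (4246393896 : 𝓞 ↥(IntermediateField.adjoin ℚ ({β} : Set (AlgebraicClosure ℚ)))) * δI + (1715885046 : 𝓞 ↥(IntermediateField.adjoin ℚ ({β} : Set (AlgebraicClosure ℚ)))) * δI ^ 2 + (-952873848 : 𝓞 ↥(IntermediateField.adjoin ℚ ({β} : Set (AlgebraicClosure ℚ))))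 * θI + (-1497143250 : 𝓞 ↥(IntermediateField.adjoin ℚ ({β} : Set (AlgebraicClosure ℚ)))) * θI * δI + (462590784 : 𝓞 ↥(IntermediateField.adjoin ℚ ({β} : Set (AlgebraicClosure ℚ)))) * θI ^ 2) * hX2 + ((-468641358 : 𝓞 ↥(IntermediateField.adjoin ℚ ({β} : Set (AlgebraicClosure ℚ)))) + (-3220783560 : 𝓞 ↥(IntermediateField.adjoin ℚ ({β} : Set (AlgebraicClosure ℚ)))) * δI + (-790703478 : 𝓞 ↥(IntermediateField.adjoin ℚ ({β} : Set (AlgebraicClosure ℚ)))) * δI ^ 2) * hXY + ((102181878 : 𝓞 ↥(IntermediateField.adjoin ℚ ({β} : Set (AlgebraicClosure ℚ)))) + (683917668 : 𝓞 ↥(IntermediateField.adjoin ℚ ({β} : Set (AlgebraicClosure ℚ)))) * δI + (109370898 : 𝓞 ↥(IntermediateField.adjoin ℚ ({β} : Set (AlgebraicClosure ℚ)))) * δI ^ 2) * hY2⟩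
  have hψq : ψ ((7 : 𝓞 ↥(IntermediateField.adjoin ℚ ({β} : Set (AlgebraicClosure ℚ)))) + (-2 : 𝓞 ↥(IntermediateField.adjoin ℚ ({β} : Set (AlgebraicClosure ℚ)))) * θI + (0 : 𝓞 ↥(IntermediateField.adjoin ℚ ({β} : Set (AlgebraicClosure ℚ)))) * δI) = 0 := by
    simp only [map_add, map_mul, map_neg, map_ofNat, map_zero, hψ, hψδ]; push_cast; decide
  have hεy : ((1 : 𝓞 ↥(IntermediateField.adjoin ℚ ({β} : Set (AlgebraicClosure ℚ)))) + (0 : 𝓞 ↥(IntermediateField.adjoin ℚ ({β} : Set (AlgebraicClosure ℚ)))) * θI + (0 : 𝓞 ↥(IntermediateField.adjoin ℚ ({β} : Set (AlgebraicClosure ℚ)))) * δI) * ((1 : 𝓞 ↥(IntermediateField.adjoin ℚ ({β} : Set (AlgebraicClosure ℚ)))) + (0 : 𝓞 ↥(IntermediateField.adjoin ℚ ({β} : Set (AlgebraicClosure ℚ)))) * θI + (0 : 𝓞 ↥(IntermediateField.adjoin ℚ ({β} : Set (AlgebraicClosure ℚ)))) * δI) = 1 := by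
    linear_combination ((0 : 𝓞 ↥(IntermediateField.adjoin ℚ ({β} : Set (AlgebraicClosure ℚ))))) * hX2 + ((0 : 𝓞 ↥(IntermediateField.adjoin ℚ ({β} : Set (AlgebraicClosure ℚ))))) * hXY + ((0 : 𝓞 ↥(IntermediateField.adjoin ℚ ({β} : Set (AlgebraicClosure ℚ))))) * hY2
  exact AlignedTransportAtTwoCubicSplitStratumLayerTwoGeneralRelationDoor.classicalMuVanishes_adjoin_of_generalRelationCert_layer_two_splitStratum ((⟨1, 1, 1, -244, -1572⟩ : WeierstrassCurve ℤ).baseChange ℚ) hord ht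
    minimalDiscriminantInt_emod_eight_n10913 Δ_n10913_neg hβ (not_two_dvd_classNumber_cubicField_n10913 hβ) hd
    (Ideal.span {((-35 : 𝓞 ↥(IntermediateField.adjoin ℚ ({β} : Set (AlgebraicClosure ℚ)))) + (17 : 𝓞 ↥(IntermediateField.adjoin ℚ ({β} : Set (AlgebraicClosure ℚ)))) * θI + (-4 : 𝓞 ↥(IntermediateField.adjoin ℚ ({β} : Set (AlgebraicClosure ℚ)))) * δI)}) hN' hε' (Ideal.span {((-1 : 𝓞 ↥(IntermediateField.adjoin ℚ ({β} : Set (AlgebraicClosure ℚ)))) + (-3 : 𝓞 ↥(IntermediateField.adjoin ℚ ({β} : Set (AlgebraicClosure ℚ)))) * θI + (3 : 𝓞 ↥(IntermediateField.adjoin ℚ ({β} : Set (AlgebraicClosure ℚ)))) * δI)}) hN1 hε hnsq κP hκP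
    ((7 : 𝓞 ↥(IntermediateField.adjoin ℚ ({β} : Set (AlgebraicClosure ℚ)))) + (-2 : 𝓞 ↥(IntermediateField.adjoin ℚ ({β} : Set (AlgebraicClosure ℚ)))) * θI + (0 : 𝓞 ↥(IntermediateField.adjoin ℚ ({β} : Set (AlgebraicClosure ℚ)))) * δI) hmax hπ 8 (q := 113) (by norm_num) ψ hψq (ti := 57) (by decide) (by decide)
    ((-117 : 𝓞 ↥(IntermediateField.adjoin ℚ ({β} : Set (AlgebraicClosure ℚ)))) + (-202 : 𝓞 ↥(IntermediateField.adjoin ℚ ({β} : Set (AlgebraicClosure ℚ)))) * θI + (-378 : 𝓞 ↥(IntermediateField.adjoin ℚ ({β} : Set (AlgebraicClosure ℚ)))) * δI) ((14 : 𝓞 ↥(IntermediateField.adjoin ℚ ({β} : Set (AlgebraicClosure ℚ)))) + (84 : 𝓞 ↥(IntermediateField.adjoin ℚ ({β} : Set (AlgebraicClosure ℚ)))) * θI + (-11 : 𝓞 ↥(IntermediateField.adjoin ℚ ({β} : Set (AlgebraicClosure ℚ)))) * δI) (by push_cast; linear_combination ((674648 : 𝓞 ↥(IntermediateField.adjoin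 ℚ ({β} : Set (AlgebraicClosure ℚ)))) + (-435568 : 𝓞 ↥(IntermediateField.adjoin ℚ ({β} : Set (AlgebraicClosure ℚ)))) * δI + (-12096 : 𝓞 ↥(IntermediateField.adjoin ℚ ({β} : Set (AlgebraicClosure ℚ)))) * δI ^ 2 + (-257952 : 𝓞 ↥(IntermediateField.adjoin ℚ ({β} : Set (AlgebraicClosure ℚ)))) * θI + (84256 : 𝓞 ↥(IntermediateField.adjoin ℚ ({β} : Set (AlgebraicClosure ℚ)))) * θI * δI + (46608 : 𝓞 ↥(IntermediateField.adjoin ℚ ({β} : Set (AlgebraicClosure ℚ)))) * θI ^ 2 + (-6048 : 𝓞 ↥(IntermediateField.adjoin ℚ ({β} : Set (AlgebraicClosure ℚ)))) * θI ^ 2 * δI + (-3232 : 𝓞 ↥(IntermediateField.adjoin ℚ ({β} : Set (AlgebraicClosure ℚ)))) * θI ^ 3) * hX2 + ((83040 : 𝓞 ↥(IntermediateField.adjoin ℚ ({β} : Set (AlgebraicClosure ℚ)))) + (180608 : 𝓞 ↥(IntermediateField.adjoin ℚ ({β} : Set (AlgebraicClosure ℚ)))) * δI) * hXY + ((-31072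 : 𝓞 ↥(IntermediateField.adjoin ℚ ({β} : Set (AlgebraicClosure ℚ)))) + (-24192 : 𝓞 ↥(IntermediateField.adjoin ℚ ({β} : Set (AlgebraicClosure ℚ)))) * δI) * hY2)
    ((-3241 : 𝓞 ↥(IntermediateField.adjoin ℚ ({β} : Set (AlgebraicClosure ℚ)))) + (8334 : 𝓞 ↥(IntermediateField.adjoin ℚ ({β} : Set (AlgebraicClosure ℚ)))) * θI + (-3704 : 𝓞 ↥(IntermediateField.adjoin ℚ ({β} : Set (AlgebraicClosure ℚ)))) * δI) ((109 : 𝓞 ↥(IntermediateField.adjoin ℚ ({β} : Set (AlgebraicClosure ℚ))))) (by push_cast; linear_combination ((-16668 : 𝓞 ↥(IntermediateField.adjoin ℚ ({β} : Set (AlgebraicClosure ℚ))))) * hX2 + ((7408 : 𝓞 ↥(IntermediateField.adjoin ℚ ({β} : Set (AlgebraicClosure ℚ))))) * hXY + ((0 : 𝓞 ↥(IntermediateField.adjoin ℚ ({β} : Set (AlgebraicClosure ℚ))))) * hY2)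
    ((7 : 𝓞 ↥(IntermediateField.adjoin ℚ ({β} : Set (AlgebraicClosure ℚ)))) + (-18 : 𝓞 ↥(IntermediateField.adjoin ℚ ({β} : Set (AlgebraicClosure ℚ)))) * θI + (8 : 𝓞 ↥(IntermediateField.adjoin ℚ ({β} : Set (AlgebraicClosure ℚ)))) * δI) ((7 : 𝓞 ↥(IntermediateField.adjoin ℚ ({β} : Set (AlgebraicClosure ℚ))))) (by push_cast; linear_combination ((36 : 𝓞 ↥(IntermediateField.adjoin ℚ ({β} : Set (AlgebraicClosure ℚ))))) * hX2 + ((-16 : 𝓞 ↥(IntermediateField.adjoin ℚ ({β} : Set (AlgebraicClosure ℚ))))) * hXY + ((0 : 𝓞 ↥(IntermediateField.adjoin ℚ ({β} : Set (AlgebraicClosure ℚ))))) * hY2)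
    ((2919 : 𝓞 ↥(IntermediateField.adjoin ℚ ({β} : Set (AlgebraicClosure ℚ)))) + (-7506 : 𝓞 ↥(IntermediateField.adjoin ℚ ({β} : Set (AlgebraicClosure ℚ)))) * θI + (3336 : 𝓞 ↥(IntermediateField.adjoin ℚ ({β} : Set (AlgebraicClosure ℚ)))) * δI) ((95 : 𝓞 ↥(IntermediateField.adjoin ℚ ({β} : Set (AlgebraicClosure ℚ))))) (by push_cast; linear_combination ((15012 : 𝓞 ↥(IntermediateField.adjoin ℚ ({β} : Set (AlgebraicClosure ℚ))))) * hX2 + ((-6672 : 𝓞 ↥(IntermediateField.adjoin ℚ ({β} : Set (AlgebraicClosure ℚ))))) * hXY + ((0 : 𝓞 ↥(IntermediateField.adjoin ℚ ({β} : Set (AlgebraicClosure ℚ))))) * hY2)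
    3 1 0 0 (n := 4) (d := 1) (by norm_num) (by norm_num) (u := 1) (g := (C (2 : ℤ) : ℤ[X])) (by norm_num)
    (by simp only [eq_intCast]; push_cast; ring)
    ((31 : 𝓞 ↥(IntermediateField.adjoin ℚ ({β} : Set (AlgebraicClosure ℚ)))) + (-12 : 𝓞 ↥(IntermediateField.adjoin ℚ ({β} : Set (AlgebraicClosure ℚ)))) * θI + (2 : 𝓞 ↥(IntermediateField.adjoin ℚ ({β} : Set (AlgebraicClosure ℚ)))) * δI) ((-13 : 𝓞 ↥(IntermediateField.adjoin ℚ ({β} : Set (AlgebraicClosure ℚ)))) + (7 : 𝓞 ↥(IntermediateField.adjoin ℚ ({β} : Set (AlgebraicClosure ℚ)))) * θI + (-2 : 𝓞 ↥(IntermediateField.adjoin ℚ ({β} : Set (AlgebraicClosure ℚ)))) * δI) ((34 : 𝓞 ↥(IntermediateField.adjoin ℚ ({β} : Set (AlgebraicClosure ℚ)))) + (-16 : 𝓞 ↥(IntermediateField.adjoin ℚ ({β} : Set (AlgebraicClosure ℚ)))) * θI + (4 : 𝓞 ↥(IntermediateField.adjoin ℚ ({β} : Set (AlgebraicClosure ℚ))))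 * δI) ((-20 : 𝓞 ↥(IntermediateField.adjoin ℚ ({β} : Set (AlgebraicClosure ℚ)))) + (12 : 𝓞 ↥(IntermediateField.adjoin ℚ ({β} : Set (AlgebraicClosure ℚ)))) * θI + (-3 : 𝓞 ↥(IntermediateField.adjoin ℚ ({β} : Set (AlgebraicClosure ℚ)))) * δI) hm0 hm1 hm2 hm3
    (Units.mkOfMulEqOne _ _ hεy) (by rw [Units.val_mkOfMulEqOne]; linear_combination ((-45536 : 𝓞 ↥(IntermediateField.adjoin ℚ ({β} : Set (AlgebraicClosure ℚ)))) + (-6568 : 𝓞 ↥(IntermediateField.adjoin ℚ ({β} : Set (AlgebraicClosure ℚ)))) * δI + (448 : 𝓞 ↥(IntermediateField.adjoin ℚ ({β} : Set (AlgebraicClosure ℚ)))) * δI ^ 2 + (15004 : 𝓞 ↥(IntermediateField.adjoin ℚ ({β} : Set (AlgebraicClosure ℚ)))) * θI + (-672 : 𝓞 ↥(IntermediateField.adjoin ℚ ({β} : Set (AlgebraicClosure ℚ)))) * θI * δI + (-204 : 𝓞 ↥(IntermediateField.adjoin ℚ ({β} : Set (AlgebraicClosure ℚ)))) * θI ^ 2)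 * hX2 + ((39360 : 𝓞 ↥(IntermediateField.adjoin ℚ ({β} : Set (AlgebraicClosure ℚ)))) + (-1312 : 𝓞 ↥(IntermediateField.adjoin ℚ ({β} : Set (AlgebraicClosure ℚ)))) * δI + (-32 : 𝓞 ↥(IntermediateField.adjoin ℚ ({β} : Set (AlgebraicClosure ℚ)))) * δI ^ 2) * hXY + ((-8440 : 𝓞 ↥(IntermediateField.adjoin ℚ ({β} : Set (AlgebraicClosure ℚ)))) + (568 : 𝓞 ↥(IntermediateField.adjoin ℚ ({β} : Set (AlgebraicClosure ℚ)))) * δI + (-8 : 𝓞 ↥(IntermediateField.adjoin ℚ ({β} : Set (AlgebraicClosure ℚ)))) * δI ^ 2) * hY2)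

/-- ★★ **`μ₂(κ) = 0` — UNCONDITIONAL — for every cyclotomic `ℤ₂`-extension `κ` of the cubic `2`-torsion field of `⟨1, 1, 1, -244, -1572⟩`** (field `−1559`), by the
split-stratum general layer-two relation road. [cite: Washington1997, §13.3] [cite: LMFDB, number field 3.1.1559.1] -/
theorem classicalMuVanishes_cubicField_n10913_unconditional {β : AlgebraicClosure ℚ} (hβ : aeval β ((⟨1, 1, 1, -244, -1572⟩ : WeierstrassCurve ℤ).baseChange ℚ).twoTorsionPolynomial.toPoly = 0)
    (κP : ZpExtension ↥(IntermediateField.adjoin ℚ ({β} : Set (AlgebraicClosure ℚ))) 2) (hκP : κP.IsCyclotomic) : ClassicalMuVanishes κP :=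
  (classGroupPRank_le_and_mu_lambda_cubicField_n10913 hβ κP hκP).2.1

/-! ## §4 `MC₂(W)` at the seed modulo PRINT (att-p5 g24's cubic carrier road with its `μ₂ = 0` input DISCHARGED) -/

/-- The `2`-division cubic of `⟨1, 1, 1, -244, -1572⟩` has a root in `ℚ̄`. [cite: SilvermanAEC2009, III.1] -/
theorem exists_root_twoTorsionPolynomial_n10913 :
    ∃ β : AlgebraicClosure ℚ, aeval β ((⟨1, 1, 1, -244, -1572⟩ : WeierstrassCurve ℤ).baseChange ℚ).twoTorsionPolynomial.toPoly = 0 := by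
  apply IsAlgClosed.exists_aeval_eq_zero
  rw [Cubic.degree_of_a_ne_zero (by simp [WeierstrassCurve.twoTorsionPolynomial])]
  decide

/-- ★ **`C2` AT THE SEED `⟨1, 1, 1, -244, -1572⟩` (`N = 10913`) modulo PRINT⁵ + MuIneqʳ + the crux's own hypotheses at this `W`** — att-p5 g24's carrier road with its
`μ₂ = 0` input DISCHARGED by the split-stratum layer-two relation row.  CONDITIONAL; BSD is NOT proved; nothing is closed.
[cite: Kato2004Asterisque, Thm. 17.4 (1)(2) (p. 273)] [cite: GreenbergLNM1716, Thm. 4.1 (p. 102) and Conj. 1.11 (p. 58)] [cite: Iwasawa1973MuInvariants, Thm. 2 and Thm. 3] -/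
theorem mazurMainConjecture_two_n10913_of_print
    [((⟨1, 1, 1, -244, -1572⟩ : WeierstrassCurve ℤ).baseChange ℚ).IsElliptic] [((⟨1, 1, 1, -244, -1572⟩ : WeierstrassCurve ℤ).baseChange ℚ).IsGloballyMinimal]
    (h17 : ∀ [NeZero (((⟨1, 1, 1, -244, -1572⟩ : WeierstrassCurve ℤ).baseChange ℚ).conductorNorm ℤ)] (f : CuspForm (Gamma0 (((⟨1, 1, 1, -244, -1572⟩ : WeierstrassCurve ℤ).baseChange ℚ).conductorNorm ℤ)) 2),
      kato_divisibility_allPrimes ((⟨1, 1, 1, -244, -1572⟩ : WeierstrassCurve ℤ).baseChange ℚ) 2 (f := f))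
    (hGr : Greenberg1999.thm41_charValue_rankZero_anyPrime)
    (hper : realPeriodRat_eq_unit_mul_plusPeriod_two) (hmod : nonempty_modularParametrizationData)
    (hGZK : rank_eq_analyticRank_of_analyticRank_le_one)
    (hI : ∀ (W : WeierstrassCurve ℚ) [W.IsElliptic] [W.IsGloballyMinimal], IsOrdinaryAt W 2 →
      (∀ x : ℚ, ¬ HasRationalTwoTorsionX W x) →
      ∀ (κ : ZpExtension ℚ 2) (γ : Field.absoluteGaloisGroup ℚ), κ.IsCyclotomic →
      κ.IsTopGenerator γ → IsCyclotomicVariable 2 γ →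
      ∀ ⦃N : ℕ⦄ [NeZero N] (f : CuspForm (Gamma0 N) 2), IsNewformOf W f →
      ∀ Gp : IwasawaAlgebra 2, iwasawaToPowerSeries 2 Gp = padicLFunction f (unitRoot W 2 : ℚ_[2]) →
      ∀ (D : W.SelmerDualData κ γ) (Yr : W.FineSelmerDualDataRelaxedInf κ γ),
        lengthAt (IwasawaAlgebra 2) D.X ⟨IwasawaAlgebra.augIdealP 2, IwasawaAlgebra.isPrime_augIdealP_holds 2⟩ ≤
          lengthAt (IwasawaAlgebra 2) (IwasawaAlgebra 2 ⧸ Ideal.span {Gp})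
              ⟨IwasawaAlgebra.augIdealP 2, IwasawaAlgebra.isPrime_augIdealP_holds 2⟩ +
            lengthAt (IwasawaAlgebra 2) Yr.X ⟨IwasawaAlgebra.augIdealP 2, IwasawaAlgebra.isPrime_augIdealP_holds 2⟩)
    (hr : ((⟨1, 1, 1, -244, -1572⟩ : WeierstrassCurve ℤ).baseChange ℚ).analyticRank = 0)
    (hμan : ∀ ⦃N : ℕ⦄ [NeZero N] (f : CuspForm (Gamma0 N) 2), IsNewformOf ((⟨1, 1, 1, -244, -1572⟩ : WeierstrassCurve ℤ).baseChange ℚ) f →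
      ∀ G : IwasawaAlgebra 2, IsEvenBranchLiftAtTwo ((⟨1, 1, 1, -244, -1572⟩ : WeierstrassCurve ℤ).baseChange ℚ) f G → red G ≠ 0)
    (hbsd : BSDp ((⟨1, 1, 1, -244, -1572⟩ : WeierstrassCurve ℤ).baseChange ℚ) 2) :
    MazurMainConjecture ((⟨1, 1, 1, -244, -1572⟩ : WeierstrassCurve ℤ).baseChange ℚ) 2 := by
  obtain ⟨β, hβ⟩ := exists_root_twoTorsionPolynomial_n10913
  have hord : IsOrdinaryAt ((⟨1, 1, 1, -244, -1572⟩ : WeierstrassCurve ℤ).baseChange ℚ) 2 := goodOrd_two_n10913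
  exact mazurMainConjecture_two_of_muIneqRel_of_classicalMu_cubicField_of_Δ_neg ((⟨1, 1, 1, -244, -1572⟩ : WeierstrassCurve ℤ).baseChange ℚ) h17 hGr hper hmod hGZK hI hord
    not_hasRationalTwoTorsionX_n10913 Δ_n10913_neg hr hμan hbsd hβ (fun κP hκP =>
      (classGroupPRank_le_and_mu_lambda_cubicField_n10913 hβ κP hκP).2.1)

end Summit.BirchSwinnertonDyer.BirchSwinnertonDyer.Theorems.AlignedTransportAtTwoCubicSplitStratumLayerTwoGeneralRelationRowN10913

end

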